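import Mathlib
import Summits.Ventures.PercRepro2.TypedPendantA3AtRoot

/-!
# The pendant `a₃` at a root, II: the row `(N₀, N₀ + C, C, 0)` and its sign (blind cell
PercRepro2, mine-2 g54, 2026-08-29; `conjectures/MINE-2.md` M2-115)

With the class-`2` identities of `TypedPendantA3AtRoot.lean` (`typedCount_pendant_a3_at_a2`,
`typedCount_pendant_a3_at_a1`: `N₂` is the `Q`-weighted spectator count of a two-copy covariance),
the other classes of a pendant `a₃` at a root follow: the class-`3` base vanishes (`a₃` lies in a
root cluster in every copy, so every kernel term carries a `1_PD` of the first or the second copy: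
`typedCount_pendant_a3_at_a2_three`, `_a1_three`), and the class-`1` base is `N₀ + N₂` by the
quadratic identity `typedCount_pendant_a3_quadratic` (`typedCount_pendant_a3_at_a2_one`,
`_a1_one`).  The covariance kernel `Cov(1_{o∈C(a₁)}, σ_b)` is the same-side kernel of the pair
`(o, b)` at `a₁` plus the cross kernel of `(o, b)` (`covKer_iL_sigma_eq`; the mirror
`covKer_iH_sigma_mirror_eq`), so `N₂ ≥ 0` under the typed same-side and cross statements for the
pair (`typedCount_pendant_a3_at_a2_two_nonneg`, `_a1_two_nonneg`), and row 2′TRI at a pendant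
`a₃` at a root reduces to the `a₃`-inactive base plus those two two-copy statements
(`typedCount_nonneg_pendant_a3_at_a2`, `_a1`).  Own work; standard axioms.
-/

namespace Summit.Ventures.PercRepro2

namespace CovForm

namespace TypedRed

open OneTyped

section Classes

open Classical

variable {V : Type*} {E : Type*} [Fintype E] [DecidableEq E] {R : Type*} [Field R]
variable (ends : E → Sym2 V) (o a₁ a₂ a₃ b : V)

/-- **Class `3` at `a₂` vanishes**: with `f = {a₃, a₂}` open in every copy, `a₃ ∈ C(a₂)` and every
kernel term carries a `1_PD`. -/
theorem typedCount_pendant_a3_at_a2_three {f : E} (hf : ends f = s(a₃, a₂))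
    (F : Finset E) (hfF : f ∈ F) (z : Config E) (τ : E → ℕ) :
    typedCount F z (Function.update τ f 3)
        (K3 ends o a₁ a₂ a₃ b : Config E → Config E → Config E → R) = 0 := by
  rw [typedCount_split_three F f hfF]
  have h0 : ∀ x y w : Config E, (K3 ends o a₁ a₂ a₃ b (Function.update x f true)
      (Function.update y f true) (Function.update w f true) : R) = 0 := by
    intro x y w
    rw [K3_eq_KB, KB_pendant_a3_at_root_three _ _ _
      (pdB_of_H3 (st ends o a₁ a₂ a₃ b (Function.update x f true))
        (decide_eq_true (conn_symm (conn_of_openAdj ⟨f, Function.update_self f true x, hf⟩))))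
      (pdB_of_H3 (st ends o a₁ a₂ a₃ b (Function.update y f true))
        (decide_eq_true (conn_symm (conn_of_openAdj ⟨f, Function.update_self f true y, hf⟩))))]
    simp
  rw [typedCount_congr_K _ _ _ h0]
  unfold typedCount
  simp

/-- **Class `3` at `a₁` vanishes** (the mirror). -/
theorem typedCount_pendant_a3_at_a1_three {f : E} (hf : ends f = s(a₃, a₁))
    (F : Finset E) (hfF : f ∈ F) (z : Config E) (τ : E → ℕ) :
    typedCount F z (Function.update τ f 3)
        (K3 ends o a₁ a₂ a₃ b : Config E → Config E → Config E → R) = 0 := by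
  rw [typedCount_split_three F f hfF]
  have h0 : ∀ x y w : Config E, (K3 ends o a₁ a₂ a₃ b (Function.update x f true)
      (Function.update y f true) (Function.update w f true) : R) = 0 := by
    intro x y w
    rw [K3_eq_KB, KB_pendant_a3_at_root_three _ _ _
      (pdB_of_L3 (st ends o a₁ a₂ a₃ b (Function.update x f true))
        (decide_eq_true (conn_symm (conn_of_openAdj ⟨f, Function.update_self f true x, hf⟩))))
      (pdB_of_L3 (st ends o a₁ a₂ a₃ b (Function.update y f true))
        (decide_eq_true (conn_symm (conn_of_openAdj ⟨f, Function.update_self f true y, hf⟩))))]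
    simp
  rw [typedCount_congr_K _ _ _ h0]
  unfold typedCount
  simp

/-- **Class `1` at `a₂`**: `N₁ = N₀ + N₂` (the quadratic identity with `N₃ = 0`). -/
theorem typedCount_pendant_a3_at_a2_one {f : E} (hf : ends f = s(a₃, a₂))
    (hleaf : ∀ e, a₃ ∈ ends e → e = f) (h32 : a₃ ≠ a₂) (h3o : a₃ ≠ o) (h31 : a₃ ≠ a₁)
    (h3b : a₃ ≠ b) (F : Finset E) (hfF : f ∈ F) (z : Config E) (τ : E → ℕ) :
    typedCount F z (Function.update τ f 1)
        (K3 ends o a₁ a₂ a₃ b : Config E → Config E → Config E → R) =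
      typedCount F z (Function.update τ f 0) (K3 ends o a₁ a₂ a₃ b) +
        typedCount F z (Function.update τ f 2) (K3 ends o a₁ a₂ a₃ b) := by
  have hq := typedCount_pendant_a3_quadratic (R := R) ends o a₁ a₂ a₃ b hf hleaf h32 h3o h31 h32
    h3b F hfF z τ
  rw [typedCount_pendant_a3_at_a2_three ends o a₁ a₂ a₃ b hf F hfF z τ, add_zero] at hq
  exact hq.symm

/-- **Class `1` at `a₁`**: `N₁ = N₀ + N₂` (the mirror). -/
theorem typedCount_pendant_a3_at_a1_one {f : E} (hf : ends f = s(a₃, a₁))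
    (hleaf : ∀ e, a₃ ∈ ends e → e = f) (h31 : a₃ ≠ a₁) (h3o : a₃ ≠ o) (h32 : a₃ ≠ a₂)
    (h3b : a₃ ≠ b) (F : Finset E) (hfF : f ∈ F) (z : Config E) (τ : E → ℕ) :
    typedCount F z (Function.update τ f 1)
        (K3 ends o a₁ a₂ a₃ b : Config E → Config E → Config E → R) =
      typedCount F z (Function.update τ f 0) (K3 ends o a₁ a₂ a₃ b) +
        typedCount F z (Function.update τ f 2) (K3 ends o a₁ a₂ a₃ b) := by
  have hq := typedCount_pendant_a3_quadratic (R := R) ends o a₁ a₂ a₃ b hf hleaf h31 h3o h31 h32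
    h3b F hfF z τ
  rw [typedCount_pendant_a3_at_a1_three ends o a₁ a₂ a₃ b hf F hfF z τ, add_zero] at hq
  exact hq.symm

end Classes

/-! ## The covariance kernel is the same-side kernel plus the cross kernel, and the sign -/

section Nonneg

open Classical

variable {V : Type*} {E : Type*} [Fintype E] [DecidableEq E] {R : Type*} [Field R]
variable (ends : E → Sym2 V) (o a₁ a₂ a₃ b : V)

omit [Fintype E] [DecidableEq E] in
/-- `Cov(1_{o∈C(a₁)}, σ_b) = same-side kernel of `(o, b)` at `a₁` + cross kernel of `(o, b)`. -/
lemma covKer_iL_sigma_eq (y w : Config E) :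
    TypedA3.covKer (R := R) ends a₁ a₂ (iL ends a₁ o) (sigma ends a₁ a₂ b) y w =
      TypedA3.sameKernel ends a₁ a₂ o b y w + crossKernel ends a₁ a₂ o b y w := by
  unfold TypedA3.covKer TypedA3.sameKernel crossKernel sigma iQ iL iH
  rw [PendantRoot.avoidAll_eq_compl]
  ring

omit [Fintype E] [DecidableEq E] in
/-- The mirror: `Cov(1_{o∈C(a₂)}, −σ_b)` = same-side kernel of `(o, b)` at `a₂` + cross kernel
with the roots exchanged. -/
lemma covKer_iH_sigma_mirror_eq (y w : Config E) :
    TypedA3.covKer (R := R) ends a₁ a₂ (iH ends a₂ o) (sigma ends a₂ a₁ b) y w =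
      TypedA3.sameKernel ends a₂ a₁ o b y w + crossKernel ends a₂ a₁ o b y w := by
  unfold TypedA3.covKer TypedA3.sameKernel crossKernel sigma iQ iL iH
  have hc : ((connEvent ends a₂ a₁)ᶜ : Set (Config E)) = (connEvent ends a₁ a₂)ᶜ := by
    rw [← PendantRoot.avoidAll_eq_compl, ← PendantRoot.avoidAll_eq_compl,
      A3Inactive.avoidAll_singleton_comm]
  rw [PendantRoot.avoidAll_eq_compl, hc]
  ring

variable [LinearOrder R] [IsStrictOrderedRing R]

/-- **The class-`2` base at `a₂` is nonnegative** under the typed same-side statement for `(o, b)`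
at `a₁` and the typed cross statement for `(o, b)` (types in `{1, 2}` on the other typed edges). -/
theorem typedCount_pendant_a3_at_a2_two_nonneg {f : E} (hf : ends f = s(a₃, a₂))
    (hleaf : ∀ e, a₃ ∈ ends e → e = f) (h32 : a₃ ≠ a₂) (h3o : a₃ ≠ o) (h31 : a₃ ≠ a₁)
    (h3b : a₃ ≠ b) (F : Finset E) (hfF : f ∈ F) (z : Config E) (τ : E → ℕ)
    (hτ : ∀ e ∈ F, e ≠ f → τ e = 1 ∨ τ e = 2)
    (hs : TypedA3.SameCount (R := R) ends a₁ a₂ o b) (hc : CrossCount R ends a₁ a₂ o b) :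
    0 ≤ typedCount F z (Function.update τ f 2)
        (K3 ends o a₁ a₂ a₃ b : Config E → Config E → Config E → R) := by
  rw [typedCount_pendant_a3_at_a2 ends o a₁ a₂ a₃ b hf hleaf h32 h3o h31 h3b F hfF z τ,
    typedCount_type_zero F f hfF _ _ (Function.update_self f 0 τ)]
  have hτ' : ∀ e ∈ F.erase f, Function.update τ f 0 e = 1 ∨ Function.update τ f 0 e = 2 := by
    intro e he
    rw [Function.update_of_ne (Finset.ne_of_mem_erase he)]
    exact hτ e (Finset.mem_of_mem_erase he) (Finset.ne_of_mem_erase he)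
  rw [TypedA3.typedCount_eq_sum_spec _ _ _ hτ']
  refine Finset.sum_nonneg fun x _ => ?_
  split_ifs
  · rw [TypedA3.pinnedCount_congr _ _ _ (fun y w => iQ ends a₁ a₂ x *
        (TypedA3.sameKernel (R := R) ends a₁ a₂ o b y w + crossKernel ends a₁ a₂ o b y w))
        (fun y w => by rw [covKer_iL_sigma_eq]),
      TypedA3.pinnedCount_const_mul, TypedA3.pinnedCount_add]
    exact mul_nonneg (TypedA3.iQ_nonneg ends a₁ a₂ x) (add_nonneg (hs _ _) (hc _ _))
  · exact le_rfl

/-- **The class-`2` base at `a₁` is nonnegative** (the mirror: the same-side statement at `a₂`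
and the cross statement with the roots exchanged). -/
theorem typedCount_pendant_a3_at_a1_two_nonneg {f : E} (hf : ends f = s(a₃, a₁))
    (hleaf : ∀ e, a₃ ∈ ends e → e = f) (h31 : a₃ ≠ a₁) (h3o : a₃ ≠ o) (h32 : a₃ ≠ a₂)
    (h3b : a₃ ≠ b) (F : Finset E) (hfF : f ∈ F) (z : Config E) (τ : E → ℕ)
    (hτ : ∀ e ∈ F, e ≠ f → τ e = 1 ∨ τ e = 2)
    (hs : TypedA3.SameCount (R := R) ends a₂ a₁ o b) (hc : CrossCount R ends a₂ a₁ o b) :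
    0 ≤ typedCount F z (Function.update τ f 2)
        (K3 ends o a₁ a₂ a₃ b : Config E → Config E → Config E → R) := by
  rw [typedCount_pendant_a3_at_a1 ends o a₁ a₂ a₃ b hf hleaf h31 h3o h32 h3b F hfF z τ,
    typedCount_type_zero F f hfF _ _ (Function.update_self f 0 τ)]
  have hτ' : ∀ e ∈ F.erase f, Function.update τ f 0 e = 1 ∨ Function.update τ f 0 e = 2 := by
    intro e he
    rw [Function.update_of_ne (Finset.ne_of_mem_erase he)]
    exact hτ e (Finset.mem_of_mem_erase he) (Finset.ne_of_mem_erase he)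
  rw [TypedA3.typedCount_eq_sum_spec _ _ _ hτ']
  refine Finset.sum_nonneg fun x _ => ?_
  split_ifs
  · rw [TypedA3.pinnedCount_congr _ _ _ (fun y w => iQ ends a₁ a₂ x *
        (TypedA3.sameKernel (R := R) ends a₂ a₁ o b y w + crossKernel ends a₂ a₁ o b y w))
        (fun y w => by rw [covKer_iH_sigma_mirror_eq]),
      TypedA3.pinnedCount_const_mul, TypedA3.pinnedCount_add]
    exact mul_nonneg (TypedA3.iQ_nonneg ends a₁ a₂ x) (add_nonneg (hs _ _) (hc _ _))
  · exact le_rfl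

/-- **Row 2′TRI at a pendant `a₃` at `a₂`** reduces to the `a₃`-inactive base and the two-copy
statements: every class is nonnegative. -/
theorem typedCount_nonneg_pendant_a3_at_a2 {f : E} (hf : ends f = s(a₃, a₂))
    (hleaf : ∀ e, a₃ ∈ ends e → e = f) (h32 : a₃ ≠ a₂) (h3o : a₃ ≠ o) (h31 : a₃ ≠ a₁)
    (h3b : a₃ ≠ b) (F : Finset E) (hfF : f ∈ F) (z : Config E) (τ : E → ℕ)
    (hτ : ∀ e ∈ F, e ≠ f → τ e = 1 ∨ τ e = 2)
    (hs : TypedA3.SameCount (R := R) ends a₁ a₂ o b) (hc : CrossCount R ends a₁ a₂ o b)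
    (h0 : 0 ≤ typedCount F z (Function.update τ f 0)
        (K3 ends o a₁ a₂ a₃ b : Config E → Config E → Config E → R)) (k : ℕ) :
    0 ≤ typedCount F z (Function.update τ f k)
        (K3 ends o a₁ a₂ a₃ b : Config E → Config E → Config E → R) := by
  have h2 := typedCount_pendant_a3_at_a2_two_nonneg ends o a₁ a₂ a₃ b hf hleaf h32 h3o h31 h3b F
    hfF z τ hτ hs hc
  match k with
  | 0 => exact h0
  | 1 =>
    rw [typedCount_pendant_a3_at_a2_one ends o a₁ a₂ a₃ b hf hleaf h32 h3o h31 h3b F hfF z τ]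
    exact add_nonneg h0 h2
  | 2 => exact h2
  | 3 => rw [typedCount_pendant_a3_at_a2_three ends o a₁ a₂ a₃ b hf F hfF z τ]
  | k + 4 =>
    rw [typedCount_split F f hfF]
    refine Finset.sum_nonneg fun a _ => Finset.sum_nonneg fun b' _ =>
      Finset.sum_nonneg fun c _ => ?_
    rw [Function.update_self, if_neg]
    have ha := Bool.toNat_le a
    have hb := Bool.toNat_le b'
    have hc' := Bool.toNat_le c
    omega

/-- **Row 2′TRI at a pendant `a₃` at `a₁`** (the mirror). -/
theorem typedCount_nonneg_pendant_a3_at_a1 {f : E} (hf : ends f = s(a₃, a₁))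
    (hleaf : ∀ e, a₃ ∈ ends e → e = f) (h31 : a₃ ≠ a₁) (h3o : a₃ ≠ o) (h32 : a₃ ≠ a₂)
    (h3b : a₃ ≠ b) (F : Finset E) (hfF : f ∈ F) (z : Config E) (τ : E → ℕ)
    (hτ : ∀ e ∈ F, e ≠ f → τ e = 1 ∨ τ e = 2)
    (hs : TypedA3.SameCount (R := R) ends a₂ a₁ o b) (hc : CrossCount R ends a₂ a₁ o b)
    (h0 : 0 ≤ typedCount F z (Function.update τ f 0)
        (K3 ends o a₁ a₂ a₃ b : Config E → Config E → Config E → R)) (k : ℕ) :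
    0 ≤ typedCount F z (Function.update τ f k)
        (K3 ends o a₁ a₂ a₃ b : Config E → Config E → Config E → R) := by
  have h2 := typedCount_pendant_a3_at_a1_two_nonneg ends o a₁ a₂ a₃ b hf hleaf h31 h3o h32 h3b F
    hfF z τ hτ hs hc
  match k with
  | 0 => exact h0
  | 1 =>
    rw [typedCount_pendant_a3_at_a1_one ends o a₁ a₂ a₃ b hf hleaf h31 h3o h32 h3b F hfF z τ]
    exact add_nonneg h0 h2
  | 2 => exact h2
  | 3 => rw [typedCount_pendant_a3_at_a1_three ends o a₁ a₂ a₃ b hf F hfF z τ]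
  | k + 4 =>
    rw [typedCount_split F f hfF]
    refine Finset.sum_nonneg fun a _ => Finset.sum_nonneg fun b' _ =>
      Finset.sum_nonneg fun c _ => ?_
    rw [Function.update_self, if_neg]
    have ha := Bool.toNat_le a
    have hb := Bool.toNat_le b'
    have hc' := Bool.toNat_le c
    omega

end Nonneg

end TypedRed

end CovForm

end Summit.Ventures.PercRepro2
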